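import Literature.MathematicalPhysics.QuantumFieldTheory.Balaban1983to89.B9Eq340TransporterChangeY
import Literature.MathematicalPhysics.QuantumFieldTheory.Balaban1983to89.B9Eq340TaxiTelescope

/-!
# `Balaban1983to89.B9GradLetterLadderHolonomy` — T. Bałaban, *Propagators for lattice gauge theories in a background field*, Commun. Math. Phys. **99** (1985) 389–434
# [Balaban1985BackgroundPropagators], (3.40) p. 397 with (3.3) p. 391 and (3.35) p. 396: THE LADDER HOLONOMY OF THE LETTER `J_μ` — the transporter between two bonds
# `⟨x, x+e_κ⟩`, `⟨x′, x′+e_κ⟩` along the taxicab contour of the sources versus the one of the targets, `U(Γ_{x,x′})·U_κ(x′)·U(Γ_{x+e_κ,x′+e_κ})⁻¹·U_κ(x)⁻¹`, is the signed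
# LASSO of the contour (n06-c g19 `B9Eq340StepLasso`), hence within `|Γ|·(max plaquette defect)` of `1`; under print's (3.35) on a near pair: `≤ (d+1)|x−x′|_∞·K_pl·L⁶·(L^{j})⁻²`

[4] = T. Bałaban, *Propagators and renormalization transformations for lattice gauge theories. II*, Commun. Math. Phys. **96** (1984) 223–250 [`Balaban1984PropagatorsII`].
statement-level skeleton of published theorems with citation tags; proofs where landed; nothing here is a claim about the Yang–Mills mass gap.

THE PRINT.  (3.3) p. 391 (the covariant derivative, the letter `J_μ`: *"A_μ(x) = A(x, x + ηe_μ)"*, the link variable acting by `R(U(x, x+ηe_μ))`); (3.40) p. 397 (the transported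
Hölder quotient `|R(U(Γ_{x,x′}))A(x′) − A(x)|` along *"a shortest contour Γ_{x,x′}"*); (3.35) p. 396 (the regularity class: plaquette variables close to `1`); (3.69) p. 404.

WHY THIS FILE (cell `pub-ymgap`, Track A node N06 [B9], seat `pub-ymgap-dag-n06-c` g21; `LOCATED22-ADOPTION-MEMO-g21.md` §3.3 (a), confirmed by dag-n06-l g32 I.≈31480).  The two
displayed letters `hdgDvd13 ∕ hpdgDvd13` of the N06 certificate (∇_{U,ν}G₀D_U and its probe, Hölder SOURCE) leave the display once the W-sector input class is the TRANSPORTED site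
class `bHZPIfam (taxiS U)` and the letter `J_μ(U)` of `D_U = Σ_μ ∇\*_{U,μ} ∘ J_μ(U)` (def-Y `DvcoKH_eq_sum`; `Jb U μ Φ ⟨x,μ⟩ = −R(U_μ(x)) Φ(x + e_μ)`, `B9GradViaDivLettersAtPins` :80) is
bounded from that class into the transported BOND class `bHZKPIfam (taxiB U)`.  Its transported pair term at an admissible bond pair `(⟨x,μ⟩, ⟨x′,μ⟩)` differs from the source's
pair term at the shifted sites `(x+e_μ, x′+e_μ)` EXACTLY by the holonomy of the unit-width ladder between the two `μ`-links — the object of THIS FILE: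
* §1 `legSteps_shift ∕ taxiSteps_shift_all` — def-Y's taxicab step list is invariant under translating BOTH endpoints by `e_κ` (every direction, also `κ` itself);
* §2 ★ `jLadder_eq_stepLasso` — `U(Γ_{x,z})·U_κ(z)·U(Γ_{x+e_κ,z+e_κ})⁻¹·U_κ(x)⁻¹ = stepLasso κ U (taxiSteps x z) x` (g19's signed lasso), hence ★★ `norm_jLadder_sub_one_le` —
  `‖ladder − 1‖ ≤ (d+1)·|x − z|_∞·δ` whenever every plaquette swept by the contour is within `δ` of `1` (`norm_stepLasso_sub_one_le`, `stepDefect_le_of_forall`, `|Γ| ≤ (d+1)|x−z|_∞`);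
* §3 ★★★ `norm_jLadder_sub_one_le_of_reg335P` — at node00-def-Y's letters under print's class (3.35) (`bg9KP`, `c ≤ 10`), for a NEAR site pair `|z − w|_∞ ≤ L^{j(z)}` and any rung
  direction: `‖ladder − 1‖ ≤ (d+1)|w−z|_∞·K_pl·L⁶·(L^{j(z)})⁻²`, `K_pl = 2K(1+K)e^{4K}`, `K = 10L(Mα₀)` (the swept plaquettes sit on the arcs of the pair:
  `rungSites_taxiSteps` + `B9Eq340TransporterChangeY.norm_plaqU_sub_one_le_box_of_reg335P`).
Consumer: `B9GradLetterTransportedInputClasses` (the class letter of `J_μ`), then the `hdgDvd13 ∕ hpdgDvd13` LEG.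

HONEST SCOPE.  Finite products of unit matrices and their bookkeeping; the only analytic input is the plaquette reading of (3.35) already landed; nothing of [B9]'s propagator
estimates asserted; COUNT-NEUTRAL; N06 NOT discharged; nothing continuum, nothing about the mass gap.  A NEW file; 0 `def`, no `sorry`, no `axiom`, no `instance`, no `notation`.
-/

noncomputable section

namespace Literature.MathematicalPhysics.QuantumFieldTheory.Balaban1983to89.B9GradLetterLadderHolonomy

open T4RelativeLadder (UnitaryLike)
open B4TorusKernel.MultiPeriod (torusSupNorm torusSupNorm_nonneg)
open B9BackgroundsKLevelV1 (CfgV1 shiftsV1)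
open B9BackgroundsKLevelV1P (bg9KP)
open B9Eq39Adjoint (plaqU)
open B6GlobalChartV1 (boxEquiv PV)
open B6KLevelCensusIndexV1 (KIdx kGeo)
open B9Eq340StepLasso (stepRun stepEnd stepLasso stepDefect rungSites legSteps taxiSteps parTaxiV_eq_stepRun norm_stepLasso_sub_one_le stepDefect_le_of_forall)
open B9Eq340TaxiRungs (OnArc rungSites_taxiSteps)
open B9Eq340TaxiTelescope (stepEnd_taxiSteps length_taxiSteps_le_mul_supDist)
open B9Eq340TransporterChangeY (norm_plaqU_sub_one_le_box_of_reg335P)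
open B6Ineq2142KLevelV1 (shift_apply_of_ne)
open Node00 (SiteY CfgY toKT levY parTaxiV)
open LatticeFieldCalculus (supDist)

/-! ## §1 The taxicab step list is translation invariant -/

section Steps

variable {P : Params}

/-- the translated label in the translation direction: `(x + e_μ)_μ = x_μ + 1`. [cite: Balaban1985BackgroundPropagators, (3.1) p.390, dictionary] -/
theorem shift_apply_self (x : Site P 0) (μ : Fin P.d) : (x.shift μ) μ = x μ + 1 := by
  simp only [Site.shift, Function.update_self]

/-- ONE LEG: translating start and target by `e_κ` leaves the signed steps of every leg unchanged (also the leg in direction `κ`: the step counts read `t − c`).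
[cite: Balaban1985BackgroundPropagators, (3.40) p.397 («a shortest contour»), bookkeeping] -/
theorem legSteps_shift (ν κ : Fin P.d) (p z : Site P 0) : legSteps ν ((p.shift κ) ν) ((z.shift κ) ν) = legSteps ν (p ν) (z ν) := by
  by_cases h : ν = κ
  · subst h
    simp only [shift_apply_self, legSteps, add_sub_add_right_eq_sub]
  · rw [shift_apply_of_ne p h, shift_apply_of_ne z h]

/-- ★ **TRANSLATION INVARIANCE OF THE TAXICAB STEPS**: `taxiSteps l (p + e_κ) (z + e_κ) = taxiSteps l p z` for EVERY direction `κ` (g19's `taxiSteps_shift` is the case `κ ∉ l`).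
[cite: Balaban1985BackgroundPropagators, (3.40) p.397 («a shortest contour»), bookkeeping] -/
theorem taxiSteps_shift_all (κ : Fin P.d) : ∀ (l : List (Fin P.d)) (p z : Site P 0), taxiSteps l (p.shift κ) (z.shift κ) = taxiSteps l p z
  | [], _, _ => rfl
  | ν :: l, p, z => by
    show legSteps ν ((p.shift κ) ν) ((z.shift κ) ν) ++ taxiSteps l (p.shift κ) (z.shift κ) = legSteps ν (p ν) (z ν) ++ taxiSteps l p z
    rw [legSteps_shift, taxiSteps_shift_all κ l p z]

end Steps

/-! ## §2 The ladder of the letter `J_κ` is the signed lasso of the contour -/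

section Ladder

variable {P : Params} {𝔸 : Type} [NormedRing 𝔸]

/-- ★ **THE LADDER IS THE LASSO**: `U(Γ_{x,z})·U_κ(z)·U(Γ_{x+e_κ, z+e_κ})⁻¹·U_κ(x)⁻¹ = stepLasso κ U (taxiSteps x z) x` — def-Y's taxicab transporter is the signed step run
(`parTaxiV_eq_stepRun`), the contour ends at `z` (`stepEnd_taxiSteps`), and the translated contour has the same steps (`taxiSteps_shift_all`).
[cite: Balaban1985BackgroundPropagators, (3.40) p.397, (3.3) p.391] -/
theorem jLadder_eq_stepLasso (U : CfgV1 P 𝔸) (κ : Fin P.d) (x z : Site P 0) :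
    parTaxiV U x z * U κ z * (parTaxiV U (x.shift κ) (z.shift κ))⁻¹ * (U κ x)⁻¹ = stepLasso κ U (taxiSteps (List.finRange P.d) x z) x := by
  rw [parTaxiV_eq_stepRun, parTaxiV_eq_stepRun, taxiSteps_shift_all]
  unfold stepLasso
  rw [stepEnd_taxiSteps]

/-- ★★ **THE LADDER IS CLOSE TO `1` WHEN THE SWEPT PLAQUETTES ARE**: for unitary-like link variables, if every plaquette met by the translated contour (the rung sites of
`taxiSteps x z`) is within `δ ≥ 0` of `1`, then `‖U(Γ_{x,z})U_κ(z)U(Γ_{x+e_κ,z+e_κ})⁻¹U_κ(x)⁻¹ − 1‖ ≤ (d·|x − z|_∞)·δ` (`|Γ_{x,z}| = |x−z|₁ ≤ d|x−z|_∞`).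
[cite: Balaban1985BackgroundPropagators, (3.40) p.397, (3.35) p.396; Balaban1985Averaging, (44)–(47) pp.24–25] -/
theorem norm_jLadder_sub_one_le [NormOneClass 𝔸] {U : CfgV1 P 𝔸} (hU : ∀ μ x, UnitaryLike (U μ x)) (κ : Fin P.d) (x z : Site P 0) {δ : ℝ} (hδ0 : 0 ≤ δ)
    (hδ : ∀ r ∈ rungSites (taxiSteps (List.finRange P.d) x z) x,
      ‖(plaqU (shiftsV1 P) U (if r.2.2 then r.2.1 else κ) (if r.2.2 then κ else r.2.1) r.1 : 𝔸) - 1‖ ≤ δ) :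
    ‖((parTaxiV U x z * U κ z * (parTaxiV U (x.shift κ) (z.shift κ))⁻¹ * (U κ x)⁻¹ : 𝔸ˣ) : 𝔸) - 1‖ ≤ ((P.d * supDist x z : ℕ) : ℝ) * δ := by
  rw [jLadder_eq_stepLasso]
  refine (norm_stepLasso_sub_one_le hU κ _ x).trans ((stepDefect_le_of_forall κ U _ x hδ).trans ?_)
  exact mul_le_mul_of_nonneg_right (by exact_mod_cast length_taxiSteps_le_mul_supDist x z) hδ0

end Ladder

/-! ## §3 At node00-def-Y's letters under print's class (3.35) -/

section Letters

variable {d ℓ : ℕ} {hd : 1 ≤ d + 1} {hL : Odd (ℓ + 1) ∧ 1 < ℓ + 1} {b₀ b₁ : ℝ} (i : KIdx d ℓ hd hL b₀ b₁)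

open scoped Matrix.Norms.L2Operator in
/-- ★★★ **THE LADDER HOLONOMY OF `J_κ` ON A NEAR PAIR UNDER (3.35)**: for a member of print's class (`bg9KP`, `c ≤ 10`, `G` unit-normed, `Mα₀ ≥ 0`), a near site pair
`|z − w|_∞ ≤ L^{j(z)}` and any rung direction `κ`, the transporter along the taxicab contour from `w` to `z` followed by the `κ`-link at `z`, back along the translated contour and
down the `κ`-link at `w`, is within `((d+1)·|w − z|_∞)·K_pl·L⁶·(L^{j(z)})⁻²` of `1` (`K_pl = 2K(1+K)e^{4K}`, `K = 10·L·(Mα₀)`): every swept plaquette sits on the arcs of the pair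
(`rungSites_taxiSteps`) where (3.35) reads `K_pl·L⁶·(L^{j(z)})⁻²` (`norm_plaqU_sub_one_le_box_of_reg335P`).
[cite: Balaban1985BackgroundPropagators, (3.40) p.397 + (3.35) p.396 + (3.69) p.404 + (3.3) p.391] -/
theorem norm_jLadder_sub_one_le_of_reg335P {N : ℕ} [Nonempty (Fin N)] {G : Subgroup (Matrix (Fin N) (Fin N) ℂ)ˣ}
    (U : CfgY (Matrix (Fin N) (Fin N) ℂ) i) {c α₀ : ℝ} (hc : c ≤ 10) (hMα : 0 ≤ (kGeo i).M * α₀)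
    (hreg : (bg9KP (Matrix (Fin N) (Fin N) ℂ) G i).Reg335 c α₀ U) (hG1 : ∀ u : (Matrix (Fin N) (Fin N) ℂ)ˣ, u ∈ G → ‖(u : Matrix (Fin N) (Fin N) ℂ)‖ ≤ 1)
    {z w : SiteY i} (h : torusSupNorm (toKT i).NB (z.1 - w.1) ≤ (((ℓ + 1 : ℕ) : ℝ)) ^ levY i z) (κ : Fin (d + 1)) :
    ‖((parTaxiV U ((boxEquiv i.hN).symm w) ((boxEquiv i.hN).symm z) * U κ ((boxEquiv i.hN).symm z) *
        (parTaxiV U (((boxEquiv i.hN).symm w).shift κ) (((boxEquiv i.hN).symm z).shift κ))⁻¹ * (U κ ((boxEquiv i.hN).symm w))⁻¹ :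
          (Matrix (Fin N) (Fin N) ℂ)ˣ) : Matrix (Fin N) (Fin N) ℂ) - 1‖ ≤
      ((((d + 1) * supDist ((boxEquiv i.hN).symm w) ((boxEquiv i.hN).symm z) : ℕ) : ℝ)) *
        ((2 * (10 * (kGeo i).L * ((kGeo i).M * α₀)) * (1 + 10 * (kGeo i).L * ((kGeo i).M * α₀)) * Real.exp (4 * (10 * (kGeo i).L * ((kGeo i).M * α₀))))
          * ((kGeo i).L ^ 6 * ((((kGeo i).L ^ levY i z)⁻¹) ^ 2))) := by
  have hU : ∀ μ' x, UnitaryLike (U μ' x) := fun μ' x =>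
    B9SectBGpLettersY.norm_le_one_and_inv_of_mem G hG1 (B9BackgroundsKLevelV1P.mem_of_reg335P i hreg μ' x)
  have hL1 : (1 : ℝ) ≤ (kGeo i).L := B9Eq335PlaquetteAtLettersY.one_le_L i
  have hδ0 : 0 ≤ (2 * (10 * (kGeo i).L * ((kGeo i).M * α₀)) * (1 + 10 * (kGeo i).L * ((kGeo i).M * α₀)) *
      Real.exp (4 * (10 * (kGeo i).L * ((kGeo i).M * α₀)))) * ((kGeo i).L ^ 6 * ((((kGeo i).L ^ levY i z)⁻¹) ^ 2)) := by positivity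
  refine norm_jLadder_sub_one_le (P := PV d ℓ i.m i.K hd hL) hU κ _ _ hδ0 fun r hr => ?_
  obtain ⟨-, -, hon⟩ := rungSites_taxiSteps ((boxEquiv i.hN).symm z) (List.finRange (d + 1)) (List.nodup_finRange _) ((boxEquiv i.hN).symm w) r hr
  exact norm_plaqU_sub_one_le_box_of_reg335P i U hc hMα hreg hG1 h _ _ r.1 fun κ' => (hon κ' (List.mem_finRange κ')).1

end Letters

end Literature.MathematicalPhysics.QuantumFieldTheory.Balaban1983to89.B9GradLetterLadderHolonomy

end
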